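import Literature.Topology.FourManifolds.HCobordismCancelStepProofs
import Literature.Topology.FourManifolds.HCobordismAssembly
import Literature.Topology.FourManifolds.HCobordismAuxiliaryPairProofs
import Literature.Topology.FourManifolds.HCobordismMiddleStep
import Literature.Topology.FourManifolds.HCobordismCancellationFunction
import Literature.Topology.FourManifolds.ProductCobordismProofs
import Literature.Topology.FourManifolds.CobordismProofs
import HarnessLib

/-!
# The smooth h-cobordism theorem: assembly from the frontier of Milnor's proof DAG

Topic `Literature/Topology/FourManifolds` (fact seat of the named fact
`Literature.Topology.FourManifolds.isTrivial_of_isHCobordism_of_five_le`, `HCobordism.lean`: Milnor, *Lectures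
on the h-cobordism theorem* (1965), Thm. 9.1 — a smooth h-cobordism `(W; M, N)` between closed
smooth `n`-manifolds, `n ≥ 5`, with `W` simply connected is a product `W ≅ M × [0, 1]` rel `M`).
Triage `XL`: the fact is the theorem the whole book proves.  The tree decomposes Milnor's proof
(§§2–9) into a DAG of named facts (the `HCobordism*.lean`, `MorseRearrangement*.lean`,
`PreliminaryRearrangement.lean`, `GradientLike*.lean`, `ProductCobordism*.lean` files), each
rung with a proved reduction to the rungs below it.  This file only assembles: it composes those
reductions with every discharge that has landed, so that the target, and every intermediate
rung that is itself a named fact, is stated as a consequence of exactly those of the **sixteen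
finest leaves that are still named facts** (the frontier, 2026-08-14) lying below it:

| leaf | Milnor 1965 | tree name |
|---|---|---|
| L1 | Thm. 4.4 on a slab | `Cobordism.Milnor1965_exists_isGradientLike_disjoint_spheres_slab` |
| L2 | proof of Thm. 4.1 (the invariant function `μ`) | `Cobordism.Milnor1965_exists_invariantFunction` |
| L3 | Thm. 5.4, Assertion 6 | `Cobordism.Milnor1965_cancellation_preliminaryHypothesis` |
| L4 | Thm. 5.4, Assertions 1–3 | `Cobordism.Milnor1965_cancellation_crossingField` |
| L5 | proof of 8.1 Index 0 (trajectory dichotomy) | `Cobordism.Milnor1965_mem_flowout_or_mem_unstableSet` |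
| L6 | Def. 3.1 (2) / 3.9 at index `1` | `Cobordism.Milnor1965_localStructure_index_one` |
| L7 | Def. 3.1 (2) / 3.9 at index `≥ 2` | `Cobordism.Milnor1965_localStructure_two_le_index` |
| L8 | Lemma 8.3 in `V₂₊` | `Cobordism.Milnor1965_exists_idealCircle` |
| L9 | Def. 3.9 / §4 (embedded `S_L`) | `Cobordism.Milnor1965_leftHandSphere_embedded` |
| L10 | `π₁(V₂₊) = 1` (via 3.14) | `Cobordism.Milnor1965_simplyConnected_plusLevelTwo` |
| L11 | Lemma 4.7 | `Cobordism.Milnor1965_adjust_field_right` |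
| L12 | Thm. 8.4 (range of its Remark) | `Milnor1965_isSmoothlyIsotopic_of_homotopic_of_two_mul_add_two_le` |
| L13 | Thm. 5.8 (isotopy extension) | `isAmbientIsotopic_of_isSmoothlyIsotopic` (`Isotopy.lean`) |
| L14 | proof of 7.8 (`π₁` of the levels) | `Cobordism.Milnor1965_simplyConnected_levels` |
| L15 | Thms. 7.4, 7.6, 4.1/4.2, Cor. 7.3 | `Cobordism.Milnor1965_exists_isolatedPair_middle` |
| L16 | Thm. 6.4 / Cor. 6.5 on a slab | `Cobordism.Milnor1965_secondCancellation_slab` |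

Discharged rungs used here (theorems of the tree): Thm. 2.5
(`Cobordism.exists_isMorseFunction_holds`), Lemma 3.2 (`Cobordism.Milnor1965_exists_isGradientLike_holds`),
Thm. 3.4 (`Cobordism.isTrivial_of_isMorseFunction_holds`), the one-level move and Lemma 2.8
inside Thm. 4.8 (`Cobordism.Milnor1965_finalRearrangement_of_slab`), Def. 3.9 at index `0`
(`Cobordism.Milnor1965_isOpen_rightHandSphere_of_index_zero_holds`), Thm. 5.4 Assertions 4–5
(`Cobordism.Milnor1965_cancellation_functionOfCrossingField_holds`), the continuity of trajectories and
the unstable neighbourhood (`Cobordism.Milnor1965_eventually_mem_flowout_holds`,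
`Cobordism.Milnor1965_unstableSet_mem_nhds_holds`), the insertion of the auxiliary pair with its
field (`Cobordism.Milnor1965_insert_pair_gradientLike_holds`, inside
`Cobordism.Milnor1965_exists_auxiliaryPair_of_facts`), and — for Thm. 9.2 — that a trivial
cobordism gives a diffeomorphism of its ends (`Cobordism.nonempty_diffeomorph_of_isTrivial_holds`).

Proved here, bottom-up (rung ⇐ leaves): Thm. 5.4 on a slab ⇐ L3, L4; Thm. 4.8 ⇐ L1, L2; the
`ℤ₂`-pair lemma ⇐ L5–L7; the index-`0` cancellation step ⇐ L1–L4; the trading step and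
Thm. 8.1 Index 1) ⇐ L1–L4, L8–L13; Thm. 8.1 Index 0) ⇐ L1–L7; the middle cancellation step and
Thm. 7.8 ⇐ L1–L4, L14–L16; Thm. 8.1 at one end and at both ends ⇐ L1–L13; Thm. 9.1
(`isTrivial_of_isHCobordism_of_five_le_of_frontier`) and Thm. 9.2 ⇐ L1–L16.  When the sixteen
leaves are discharged, `isTrivial_of_isHCobordism_of_five_le_holds` is
`isTrivial_of_isHCobordism_of_five_le_of_frontier` applied to the sixteen `_holds`.

## References

* J. Milnor, *Lectures on the h-cobordism theorem*, Princeton Mathematical Notes (1965):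
  Thm. 9.1 and its proof, Thm. 9.2 (PDF p. 57 of the held `book:milnornd-lectures-h-cobordism-theorem`),
  Thms. 2.5, 3.4, 4.1–4.8, 5.4, 5.8, 6.4, 7.4–7.8, 8.1–8.4. [MilnorHCobordism1965]
-/

open scoped Manifold ContDiff Topology
open Set Function

noncomputable section

namespace Literature.Topology.FourManifolds

universe u

/-! ### Layer 3: Thm. 5.4 and Thm. 4.8 on slabs, the `ℤ₂`-pair lemma -/

/-- **Milnor 1965, Thm. 5.4 on a sub-triad from the frontier**: the First Cancellation Theorem
on a slab (`Literature.Topology.FourManifolds.Cobordism.Milnor1965_firstCancellation_slab`) from Assertion 6 (L3) and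
Assertions 1–3 (L4) of its printed proof, Assertions 4–5 being the tree's theorem
`Literature.Topology.FourManifolds.Cobordism.Milnor1965_cancellation_functionOfCrossingField_holds`; by
`Cobordism.Milnor1965_firstCancellation_slab_of_parts` (`HCobordismFirstCancellation.lean`).
[cite: MilnorHCobordism1965, Thm. 5.4 and its proof (PDF pp. 27–35)] -/
theorem Cobordism.Milnor1965_firstCancellation_slab_of_frontier
    (h6 : Cobordism.Milnor1965_cancellation_preliminaryHypothesis.{u})
    (h3 : Cobordism.Milnor1965_cancellation_crossingField.{u}) :
    Cobordism.Milnor1965_firstCancellation_slab.{u} :=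
  Cobordism.Milnor1965_firstCancellation_slab_of_parts h6 h3
    Cobordism.Milnor1965_cancellation_functionOfCrossingField_holds

/-- **Milnor 1965, Thm. 4.8 (final rearrangement) from the frontier**: from Thm. 4.4 on a slab
(L1) and the trajectory-invariant function of the proof of Thm. 4.1 (L2), by
`Cobordism.Milnor1965_rearrangement_slab_of_invariantFunction` (`PreliminaryRearrangement.lean`:
Thms. 4.1/4.2 on a slab from L2) and `Cobordism.Milnor1965_finalRearrangement_of_slab`
(`MorseRearrangementProofs.lean`, where the one-level move and Lemma 2.8 are proved).
[cite: MilnorHCobordism1965, Thm. 4.8 (PDF p. 25), Thms. 4.1, 4.2, 4.4 (PDF pp. 22–23)] -/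
theorem Cobordism.Milnor1965_finalRearrangement_of_frontier
    (h44 : Cobordism.Milnor1965_exists_isGradientLike_disjoint_spheres_slab.{u})
    (hμ : Cobordism.Milnor1965_exists_invariantFunction.{u}) :
    Cobordism.Milnor1965_finalRearrangement.{u} :=
  Cobordism.Milnor1965_finalRearrangement_of_slab h44
    (Cobordism.Milnor1965_rearrangement_slab_of_invariantFunction hμ)

/-- **Milnor 1965, the `ℤ₂`-pair paragraph of the proof of Thm. 8.1 Index 0) from the
frontier**: the named fact `Literature.Topology.FourManifolds.Cobordism.Milnor1965_exists_inter_leftHandSphere_eq_singleton`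
(`HCobordismEliminationSteps.lean`) from the trajectory dichotomy (L5) and the local structure
at index `1` and `≥ 2` (L6, L7), the continuity of trajectories and the unstable neighbourhood
of an index-`0` point being the tree's theorems
`Cobordism.Milnor1965_eventually_mem_flowout_holds`, `Cobordism.Milnor1965_unstableSet_mem_nhds_holds`;
by `Cobordism.Milnor1965_exists_inter_leftHandSphere_eq_singleton_of_parts`
(`HCobordismIndexZeroBasins.lean`). [cite: MilnorHCobordism1965, proof of Thm. 8.1 Index 0 (PDF p. 54)] -/
theorem Cobordism.Milnor1965_exists_inter_leftHandSphere_eq_singleton_of_frontier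
    (hA : Cobordism.Milnor1965_mem_flowout_or_mem_unstableSet.{u})
    (h1 : Cobordism.Milnor1965_localStructure_index_one.{u})
    (h2 : Cobordism.Milnor1965_localStructure_two_le_index.{u}) :
    Cobordism.Milnor1965_exists_inter_leftHandSphere_eq_singleton.{u} :=
  Cobordism.Milnor1965_exists_inter_leftHandSphere_eq_singleton_of_parts hA
    Cobordism.Milnor1965_eventually_mem_flowout_holds
    Cobordism.Milnor1965_unstableSet_mem_nhds_holds h1 h2

/-! ### The three one-step alterations: cancel an index-`0` pair, trade an index-`1` point,
cancel a middle pair -/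

/-- **Milnor 1965, the cancellation of one index-`0`/`1` pair (proof of Thm. 8.1 Index 0),
PDF p. 54) from the frontier**: the named fact `Literature.Topology.FourManifolds.Cobordism.Milnor1965_cancel_pair_index_zero`
from L1–L4 — Thms. 4.1/4.2 on a slab (L2), Thm. 5.4 on a slab (L3, L4), Thm. 4.8 (L1, L2) and
Def. 3.9 at index `0` (the tree's theorem
`Cobordism.Milnor1965_isOpen_rightHandSphere_of_index_zero_holds`); by
`Cobordism.Milnor1965_cancel_pair_index_zero_of_parts` (`HCobordismCancelStep.lean`; cf.
`Cobordism.Milnor1965_cancel_pair_index_zero_of_leaves`, `HCobordismCancelStepProofs.lean`, which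
still lists Assertions 4–5 of Thm. 5.4 as a hypothesis).
[cite: MilnorHCobordism1965, proof of Thm. 8.1 Index 0 (PDF p. 54), via Thms. 4.2, 5.4, 4.8] -/
theorem Cobordism.Milnor1965_cancel_pair_index_zero_of_frontier
    (h44 : Cobordism.Milnor1965_exists_isGradientLike_disjoint_spheres_slab.{u})
    (hμ : Cobordism.Milnor1965_exists_invariantFunction.{u})
    (h6 : Cobordism.Milnor1965_cancellation_preliminaryHypothesis.{u})
    (h3 : Cobordism.Milnor1965_cancellation_crossingField.{u}) :
    Cobordism.Milnor1965_cancel_pair_index_zero.{u} :=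
  Cobordism.Milnor1965_cancel_pair_index_zero_of_parts
    Cobordism.Milnor1965_isOpen_rightHandSphere_of_index_zero_holds
    (Cobordism.Milnor1965_rearrangement_slab_of_invariantFunction hμ)
    (Cobordism.Milnor1965_firstCancellation_slab_of_frontier h6 h3)
    (Cobordism.Milnor1965_finalRearrangement_of_frontier h44 hμ)

/-- **Milnor 1965, the trading of one index-`1` critical point (proof of Thm. 8.1 Index 1),
PDF pp. 55–57) from the frontier**: the named fact `Literature.Topology.FourManifolds.Cobordism.Milnor1965_trade_one_index_one`
from L1–L4 and L8–L13 — the auxiliary pair (`Cobordism.Milnor1965_exists_auxiliaryPair_of_facts`,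
`HCobordismAuxiliaryPairProofs.lean`: Lemma 8.3 (L8), the embedded left-hand sphere (L9),
`π₁(V₂₊) = 1` (L10), Lemma 4.7 (L11), Thm. 8.4 (L12) and Thm. 5.8 (L13), the insertion with its
field being proved), Thms. 4.1/4.2 on a slab (L2), Thm. 5.4 on a slab (L3, L4) and Thm. 4.8
(L1, L2); by `Cobordism.Milnor1965_trade_one_index_one_of_parts` (`HCobordismTradeStep.lean`).
[cite: MilnorHCobordism1965, proof of Thm. 8.1 Index 1 (PDF pp. 55–57)] -/
theorem Cobordism.Milnor1965_trade_one_index_one_of_frontier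
    (h44 : Cobordism.Milnor1965_exists_isGradientLike_disjoint_spheres_slab.{u})
    (hμ : Cobordism.Milnor1965_exists_invariantFunction.{u})
    (h6 : Cobordism.Milnor1965_cancellation_preliminaryHypothesis.{u})
    (h3 : Cobordism.Milnor1965_cancellation_crossingField.{u})
    (hI : Cobordism.Milnor1965_exists_idealCircle.{u})
    (hE : Cobordism.Milnor1965_leftHandSphere_embedded.{u})
    (hP : Cobordism.Milnor1965_simplyConnected_plusLevelTwo.{u})
    (hG : Cobordism.Milnor1965_adjust_field_right.{u})
    (h84 : Milnor1965_isSmoothlyIsotopic_of_homotopic_of_two_mul_add_two_le.{0, u})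
    (h58 : ∀ {n : ℕ} {V : Type u} [TopologicalSpace V]
      [ChartedSpace (EuclideanSpace ℝ (Fin n)) V]
      (f g : (Metric.sphere (0 : EuclideanSpace ℝ (Fin 2)) 1) → V),
      isAmbientIsotopic_of_isSmoothlyIsotopic (I := 𝓡 1) (J := 𝓡 n) (f := f) (g := g)) :
    Cobordism.Milnor1965_trade_one_index_one.{u} :=
  Cobordism.Milnor1965_trade_one_index_one_of_parts
    (Cobordism.Milnor1965_exists_auxiliaryPair_of_facts hI hE hP hG h84 h58)
    (Cobordism.Milnor1965_rearrangement_slab_of_invariantFunction hμ)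
    (Cobordism.Milnor1965_firstCancellation_slab_of_frontier h6 h3)
    (Cobordism.Milnor1965_finalRearrangement_of_frontier h44 hμ)

/-- **Milnor 1965, the cancellation of one middle pair (proof of Thm. 7.8, PDF p. 53) from the
frontier**: the named fact `Literature.Topology.FourManifolds.Cobordism.Milnor1965_cancel_pair_middle` from L1–L4 and
L14–L16 — the simple connectivity of the levels (L14), the isolated pair with
`H⁎(c_p c_q, V⁻) = 0` (L15), the Second Cancellation Theorem on a slab (L16), Thm. 5.4 on a slab
(L3, L4) and Thm. 4.8 (L1, L2), Lemma 3.2 being proved; by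
`Cobordism.Milnor1965_cancel_pair_middle_of_parts` (`HCobordismMiddleStep.lean`).
[cite: MilnorHCobordism1965, proof of Thm. 7.8 (PDF p. 53), with Thms. 6.4, 7.4, 7.6] -/
theorem Cobordism.Milnor1965_cancel_pair_middle_of_frontier
    (h44 : Cobordism.Milnor1965_exists_isGradientLike_disjoint_spheres_slab.{u})
    (hμ : Cobordism.Milnor1965_exists_invariantFunction.{u})
    (h6 : Cobordism.Milnor1965_cancellation_preliminaryHypothesis.{u})
    (h3 : Cobordism.Milnor1965_cancellation_crossingField.{u})
    (hl : Cobordism.Milnor1965_simplyConnected_levels.{u})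
    (hip : Cobordism.Milnor1965_exists_isolatedPair_middle.{u})
    (h64 : Cobordism.Milnor1965_secondCancellation_slab.{u}) :
    Cobordism.Milnor1965_cancel_pair_middle.{u} :=
  Cobordism.Milnor1965_cancel_pair_middle_of_parts hl hip h64
    (Cobordism.Milnor1965_firstCancellation_slab_of_frontier h6 h3)
    (Cobordism.Milnor1965_finalRearrangement_of_frontier h44 hμ)

/-! ### Layer 2: Thm. 8.1 Index 0), Index 1), Thm. 8.1 at one and at both ends, Thm. 7.8 -/

/-- **Milnor 1965, Thm. 8.1 Index 0) from the frontier**: the named fact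
`Literature.Topology.FourManifolds.Cobordism.Milnor1965_cancel_index_zero` (`HCobordismIndexZeroOne.lean`) from L1–L7 — Thm. 4.8
(L1, L2), Lemma 3.2 (proved), the `ℤ₂`-pair lemma (L5–L7) and the cancellation of one pair
(L1–L4), iterated by `Cobordism.Milnor1965_cancel_index_zero_of_parts`
(`HCobordismEliminationSteps.lean`). [cite: MilnorHCobordism1965, Thm. 8.1 Index 0 and its proof (PDF p. 54)] -/
theorem Cobordism.Milnor1965_cancel_index_zero_of_frontier
    (h44 : Cobordism.Milnor1965_exists_isGradientLike_disjoint_spheres_slab.{u})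
    (hμ : Cobordism.Milnor1965_exists_invariantFunction.{u})
    (h6 : Cobordism.Milnor1965_cancellation_preliminaryHypothesis.{u})
    (h3 : Cobordism.Milnor1965_cancellation_crossingField.{u})
    (hA : Cobordism.Milnor1965_mem_flowout_or_mem_unstableSet.{u})
    (h1 : Cobordism.Milnor1965_localStructure_index_one.{u})
    (h2 : Cobordism.Milnor1965_localStructure_two_le_index.{u}) :
    Cobordism.Milnor1965_cancel_index_zero.{u} :=
  Cobordism.Milnor1965_cancel_index_zero_of_parts
    (Cobordism.Milnor1965_finalRearrangement_of_frontier h44 hμ)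
    (fun {_ _ _} _ _ _ _ => Cobordism.Milnor1965_exists_isGradientLike_holds)
    (Cobordism.Milnor1965_exists_inter_leftHandSphere_eq_singleton_of_frontier hA h1 h2)
    (Cobordism.Milnor1965_cancel_pair_index_zero_of_frontier h44 hμ h6 h3)

/-- **Milnor 1965, Thm. 8.1 Index 1) from the frontier**: the named fact
`Literature.Topology.FourManifolds.Cobordism.Milnor1965_trade_index_one` (`HCobordismIndexZeroOne.lean`) from L1–L4 and
L8–L13 — Thm. 4.8 (L1, L2) and the trading of one index-`1` point (above), iterated by
`Cobordism.Milnor1965_trade_index_one_of_parts` (`HCobordismEliminationSteps.lean`).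
[cite: MilnorHCobordism1965, Thm. 8.1 Index 1 and its proof (PDF pp. 54–57)] -/
theorem Cobordism.Milnor1965_trade_index_one_of_frontier
    (h44 : Cobordism.Milnor1965_exists_isGradientLike_disjoint_spheres_slab.{u})
    (hμ : Cobordism.Milnor1965_exists_invariantFunction.{u})
    (h6 : Cobordism.Milnor1965_cancellation_preliminaryHypothesis.{u})
    (h3 : Cobordism.Milnor1965_cancellation_crossingField.{u})
    (hI : Cobordism.Milnor1965_exists_idealCircle.{u})
    (hE : Cobordism.Milnor1965_leftHandSphere_embedded.{u})
    (hP : Cobordism.Milnor1965_simplyConnected_plusLevelTwo.{u})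
    (hG : Cobordism.Milnor1965_adjust_field_right.{u})
    (h84 : Milnor1965_isSmoothlyIsotopic_of_homotopic_of_two_mul_add_two_le.{0, u})
    (h58 : ∀ {n : ℕ} {V : Type u} [TopologicalSpace V]
      [ChartedSpace (EuclideanSpace ℝ (Fin n)) V]
      (f g : (Metric.sphere (0 : EuclideanSpace ℝ (Fin 2)) 1) → V),
      isAmbientIsotopic_of_isSmoothlyIsotopic (I := 𝓡 1) (J := 𝓡 n) (f := f) (g := g)) :
    Cobordism.Milnor1965_trade_index_one.{u} :=
  Cobordism.Milnor1965_trade_index_one_of_parts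
    (Cobordism.Milnor1965_finalRearrangement_of_frontier h44 hμ)
    (Cobordism.Milnor1965_trade_one_index_one_of_frontier h44 hμ h6 h3 hI hE hP hG h84 h58)

/-- **Milnor 1965, Thm. 8.1 at the incoming end from the frontier**: the named fact
`Literature.Topology.FourManifolds.Cobordism.Milnor1965_exists_isMorseFunction_two_le_index_left` (`HCobordismLowHandles.lean`)
from the thirteen leaves L1–L13, by Index 0) and Index 1) above and
`Cobordism.Milnor1965_exists_isMorseFunction_two_le_index_left_of_parts`
(`HCobordismIndexZeroOne.lean`: on a simply connected h-cobordism `H₀(W, V) = 0` and `W`, `V`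
are simply connected). [cite: MilnorHCobordism1965, Thm. 8.1 and its proof (PDF pp. 54–57)] -/
theorem Cobordism.Milnor1965_exists_isMorseFunction_two_le_index_left_of_frontier
    (h44 : Cobordism.Milnor1965_exists_isGradientLike_disjoint_spheres_slab.{u})
    (hμ : Cobordism.Milnor1965_exists_invariantFunction.{u})
    (h6 : Cobordism.Milnor1965_cancellation_preliminaryHypothesis.{u})
    (h3 : Cobordism.Milnor1965_cancellation_crossingField.{u})
    (hA : Cobordism.Milnor1965_mem_flowout_or_mem_unstableSet.{u})
    (h1 : Cobordism.Milnor1965_localStructure_index_one.{u})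
    (h2 : Cobordism.Milnor1965_localStructure_two_le_index.{u})
    (hI : Cobordism.Milnor1965_exists_idealCircle.{u})
    (hE : Cobordism.Milnor1965_leftHandSphere_embedded.{u})
    (hP : Cobordism.Milnor1965_simplyConnected_plusLevelTwo.{u})
    (hG : Cobordism.Milnor1965_adjust_field_right.{u})
    (h84 : Milnor1965_isSmoothlyIsotopic_of_homotopic_of_two_mul_add_two_le.{0, u})
    (h58 : ∀ {n : ℕ} {V : Type u} [TopologicalSpace V]
      [ChartedSpace (EuclideanSpace ℝ (Fin n)) V]
      (f g : (Metric.sphere (0 : EuclideanSpace ℝ (Fin 2)) 1) → V),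
      isAmbientIsotopic_of_isSmoothlyIsotopic (I := 𝓡 1) (J := 𝓡 n) (f := f) (g := g)) :
    Cobordism.Milnor1965_exists_isMorseFunction_two_le_index_left.{u} :=
  Cobordism.Milnor1965_exists_isMorseFunction_two_le_index_left_of_parts
    (Cobordism.Milnor1965_cancel_index_zero_of_frontier h44 hμ h6 h3 hA h1 h2)
    (Cobordism.Milnor1965_trade_index_one_of_frontier h44 hμ h6 h3 hI hE hP hG h84 h58)

/-- **Milnor 1965, Thm. 8.1 at both ends from the frontier** (the rung F81 of
`HCobordismTheorem.lean`, the named fact `Literature.Topology.FourManifolds.Milnor1965_exists_isMorseFunction_two_le_index`: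
the first four sentences of the proof of Thm. 9.1, PDF p. 57), from the thirteen leaves
L1–L13: Thm. 8.1 at one end (above), turned about and applied again, with Thm. 2.5 (the tree's
theorem `Cobordism.exists_isMorseFunction_holds`), by
`Milnor1965_exists_isMorseFunction_two_le_index_of_leaves` (`HCobordismAssembly.lean`).
[cite: MilnorHCobordism1965, proof of Thm. 9.1 (PDF p. 57), with Thm. 2.5 and Thm. 8.1] -/
theorem Milnor1965_exists_isMorseFunction_two_le_index_of_frontier
    (h44 : Cobordism.Milnor1965_exists_isGradientLike_disjoint_spheres_slab.{u})
    (hμ : Cobordism.Milnor1965_exists_invariantFunction.{u})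
    (h6 : Cobordism.Milnor1965_cancellation_preliminaryHypothesis.{u})
    (h3 : Cobordism.Milnor1965_cancellation_crossingField.{u})
    (hA : Cobordism.Milnor1965_mem_flowout_or_mem_unstableSet.{u})
    (h1 : Cobordism.Milnor1965_localStructure_index_one.{u})
    (h2 : Cobordism.Milnor1965_localStructure_two_le_index.{u})
    (hI : Cobordism.Milnor1965_exists_idealCircle.{u})
    (hE : Cobordism.Milnor1965_leftHandSphere_embedded.{u})
    (hP : Cobordism.Milnor1965_simplyConnected_plusLevelTwo.{u})
    (hG : Cobordism.Milnor1965_adjust_field_right.{u})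
    (h84 : Milnor1965_isSmoothlyIsotopic_of_homotopic_of_two_mul_add_two_le.{0, u})
    (h58 : ∀ {n : ℕ} {V : Type u} [TopologicalSpace V]
      [ChartedSpace (EuclideanSpace ℝ (Fin n)) V]
      (f g : (Metric.sphere (0 : EuclideanSpace ℝ (Fin 2)) 1) → V),
      isAmbientIsotopic_of_isSmoothlyIsotopic (I := 𝓡 1) (J := 𝓡 n) (f := f) (g := g)) :
    Milnor1965_exists_isMorseFunction_two_le_index.{u} :=
  Milnor1965_exists_isMorseFunction_two_le_index_of_leaves
    (fun {_ _ _} _ _ _ _ => Cobordism.exists_isMorseFunction_holds)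
    (Cobordism.Milnor1965_exists_isMorseFunction_two_le_index_left_of_frontier h44 hμ h6 h3 hA
      h1 h2 hI hE hP hG h84 h58)

/-- **Milnor 1965, Thm. 7.8 from the frontier** (the rung F78 of `HCobordismTheorem.lean`, the
named fact `Literature.Topology.FourManifolds.Milnor1965_exists_isMorseFunction_forall_not_isMCriticalPt`), from the seven
leaves L1–L4, L14–L16: Thm. 4.8 (L1, L2) and the cancellation of one middle pair (above),
iterated by `Milnor1965_exists_isMorseFunction_forall_not_isMCriticalPt_of_parts`
(`HCobordismEliminationSteps.lean`). [cite: MilnorHCobordism1965, Thm. 7.8 and its proof (PDF p. 53)] -/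
theorem Milnor1965_exists_isMorseFunction_forall_not_isMCriticalPt_of_frontier
    (h44 : Cobordism.Milnor1965_exists_isGradientLike_disjoint_spheres_slab.{u})
    (hμ : Cobordism.Milnor1965_exists_invariantFunction.{u})
    (h6 : Cobordism.Milnor1965_cancellation_preliminaryHypothesis.{u})
    (h3 : Cobordism.Milnor1965_cancellation_crossingField.{u})
    (hl : Cobordism.Milnor1965_simplyConnected_levels.{u})
    (hip : Cobordism.Milnor1965_exists_isolatedPair_middle.{u})
    (h64 : Cobordism.Milnor1965_secondCancellation_slab.{u}) :
    Milnor1965_exists_isMorseFunction_forall_not_isMCriticalPt.{u} :=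
  Milnor1965_exists_isMorseFunction_forall_not_isMCriticalPt_of_parts
    (Cobordism.Milnor1965_finalRearrangement_of_frontier h44 hμ)
    (Cobordism.Milnor1965_cancel_pair_middle_of_frontier h44 hμ h6 h3 hl hip h64)

/-! ### Layer 1: Thm. 9.1 and Thm. 9.2 on the frontier -/

section SPC4

/-- **The smooth h-cobordism theorem (Milnor 1965, Thm. 9.1) from the frontier of the DAG.**
The named fact `Literature.Topology.FourManifolds.isTrivial_of_isHCobordism_of_five_le` (`HCobordism.lean`) follows from the
sixteen finest leaves of Milnor's proof that are still named facts (L1–L16 of the module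
docstring), everything else on the way — Thm. 2.5, Lemma 3.2, Thm. 3.4, Thm. 4.8 modulo L1/L2,
Def. 3.9 at index `0`, Thm. 5.4 Assertions 4–5, the continuity of trajectories, the insertion of
the auxiliary pair, the finite inductions of Thm. 8.1 and Thm. 7.8, the turning-about of the
triad and the final assembly of the proof of Thm. 9.1 — being theorems of the tree.  Proof:
F81 and F78 from the frontier (above), then the proof of Thm. 9.1 verbatim
(`isTrivial_of_isHCobordism_of_five_le_of_milnor1965`, `HCobordismTheorem.lean`) with Thm. 3.4
(`Cobordism.isTrivial_of_isMorseFunction_holds`, `ProductCobordismProofs.lean`).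
[cite: MilnorHCobordism1965, Thm. 9.1 and its proof (PDF p. 57)] -/
theorem isTrivial_of_isHCobordism_of_five_le_of_frontier
    (h44 : Cobordism.Milnor1965_exists_isGradientLike_disjoint_spheres_slab.{u})
    (hμ : Cobordism.Milnor1965_exists_invariantFunction.{u})
    (h6 : Cobordism.Milnor1965_cancellation_preliminaryHypothesis.{u})
    (h3 : Cobordism.Milnor1965_cancellation_crossingField.{u})
    (hA : Cobordism.Milnor1965_mem_flowout_or_mem_unstableSet.{u})
    (h1 : Cobordism.Milnor1965_localStructure_index_one.{u})
    (h2 : Cobordism.Milnor1965_localStructure_two_le_index.{u})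
    (hI : Cobordism.Milnor1965_exists_idealCircle.{u})
    (hE : Cobordism.Milnor1965_leftHandSphere_embedded.{u})
    (hP : Cobordism.Milnor1965_simplyConnected_plusLevelTwo.{u})
    (hG : Cobordism.Milnor1965_adjust_field_right.{u})
    (h84 : Milnor1965_isSmoothlyIsotopic_of_homotopic_of_two_mul_add_two_le.{0, u})
    (h58 : ∀ {n : ℕ} {V : Type u} [TopologicalSpace V]
      [ChartedSpace (EuclideanSpace ℝ (Fin n)) V]
      (f g : (Metric.sphere (0 : EuclideanSpace ℝ (Fin 2)) 1) → V),
      isAmbientIsotopic_of_isSmoothlyIsotopic (I := 𝓡 1) (J := 𝓡 n) (f := f) (g := g))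
    (hl : Cobordism.Milnor1965_simplyConnected_levels.{u})
    (hip : Cobordism.Milnor1965_exists_isolatedPair_middle.{u})
    (h64 : Cobordism.Milnor1965_secondCancellation_slab.{u}) :
    isTrivial_of_isHCobordism_of_five_le.{u} :=
  isTrivial_of_isHCobordism_of_five_le_of_milnor1965.{u}
    (Milnor1965_exists_isMorseFunction_two_le_index_of_frontier h44 hμ h6 h3 hA h1 h2 hI hE hP hG
      h84 h58)
    (Milnor1965_exists_isMorseFunction_forall_not_isMCriticalPt_of_frontier h44 hμ h6 h3 hl hip h64)
    (fun {_ _ _} _ _ _ _ => Cobordism.isTrivial_of_isMorseFunction_holds)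

/-- **Milnor 1965, Thm. 9.2 from the frontier of the DAG**: h-cobordant simply connected closed
smooth manifolds of dimension `≥ 5` are diffeomorphic (the named fact
`Literature.Topology.FourManifolds.nonempty_diffeomorph_of_isHCobordant_of_five_le` of `HCobordism.lean`), from the same
sixteen leaves, by `isTrivial_of_isHCobordism_of_five_le_of_frontier`,
`nonempty_diffeomorph_of_isHCobordant_of_five_le_of_isTrivial` (`HCobordismTheorem.lean`) and the
tree's theorem `Cobordism.nonempty_diffeomorph_of_isTrivial_holds` (`CobordismProofs.lean`).
[cite: MilnorHCobordism1965, Thm. 9.2 (PDF p. 57)] -/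
theorem nonempty_diffeomorph_of_isHCobordant_of_five_le_of_frontier
    (h44 : Cobordism.Milnor1965_exists_isGradientLike_disjoint_spheres_slab.{u})
    (hμ : Cobordism.Milnor1965_exists_invariantFunction.{u})
    (h6 : Cobordism.Milnor1965_cancellation_preliminaryHypothesis.{u})
    (h3 : Cobordism.Milnor1965_cancellation_crossingField.{u})
    (hA : Cobordism.Milnor1965_mem_flowout_or_mem_unstableSet.{u})
    (h1 : Cobordism.Milnor1965_localStructure_index_one.{u})
    (h2 : Cobordism.Milnor1965_localStructure_two_le_index.{u})
    (hI : Cobordism.Milnor1965_exists_idealCircle.{u})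
    (hE : Cobordism.Milnor1965_leftHandSphere_embedded.{u})
    (hP : Cobordism.Milnor1965_simplyConnected_plusLevelTwo.{u})
    (hG : Cobordism.Milnor1965_adjust_field_right.{u})
    (h84 : Milnor1965_isSmoothlyIsotopic_of_homotopic_of_two_mul_add_two_le.{0, u})
    (h58 : ∀ {n : ℕ} {V : Type u} [TopologicalSpace V]
      [ChartedSpace (EuclideanSpace ℝ (Fin n)) V]
      (f g : (Metric.sphere (0 : EuclideanSpace ℝ (Fin 2)) 1) → V),
      isAmbientIsotopic_of_isSmoothlyIsotopic (I := 𝓡 1) (J := 𝓡 n) (f := f) (g := g))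
    (hl : Cobordism.Milnor1965_simplyConnected_levels.{u})
    (hip : Cobordism.Milnor1965_exists_isolatedPair_middle.{u})
    (h64 : Cobordism.Milnor1965_secondCancellation_slab.{u}) :
    nonempty_diffeomorph_of_isHCobordant_of_five_le.{u} :=
  nonempty_diffeomorph_of_isHCobordant_of_five_le_of_isTrivial.{u}
    (isTrivial_of_isHCobordism_of_five_le_of_frontier h44 hμ h6 h3 hA h1 h2 hI hE hP hG h84 h58
      hl hip h64)
    (fun {_ _ _} _ _ _ _ => Cobordism.nonempty_diffeomorph_of_isTrivial_holds)

end SPC4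

end Literature.Topology.FourManifolds
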